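import Literature.Geometry.Lorentzian.CauchyPieceDomain
import Literature.Geometry.Lorentzian.CausalityClosedProofs
import Summits.FinalStateConjecture.FinalStateConjecture.Theorems.SwallowTheDatumSubdataDevelopmentsEmbedDoDExtend
import HarnessLib

/-!
# Crux `TameCensorship` (stmt-FinalStateConjecture-10047), line `crush-the-swallowed-interior`,
# fact-stub F1 `stub_factFutureCauchyCrushBound` — I: causality around a local Cauchy lens

Pure causality, preparing the future-Cauchy form of Hawking's crush bound (O'Neill 1983, Ch. 14,
Thm. 14.55A, from Wald 1984, Thm. 9.5.1 = the registered stub `stub_factFutureCauchyCrushBound`,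
`HawkingCrushBound → …`, of the skeleton `Cruxes/TameCensorship/Lines/crush_the_swallowed_interior.lean`). Let `(M, g, τ)` be a time-oriented Lorentzian manifold
(Hausdorff, second countable, finite-dimensional, boundaryless model, `Cⁿ` metric with `n ≥ 2`),
`S ⊆ M` an ACHRONAL set and `V ⊆ M` an open set in which `S ∩ V` is a Cauchy hypersurface of the
open sub-spacetime `(V, g|_V, τ|_V)` — a **lens** of `S` (such `V` exist about every point of a
smooth spacelike hypersurface, `LorentzianMetric.exists_isCauchyHypersurface_restrict_of_timeFunction`,
`LocalCauchyLens.lean`). We prove: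

* `mem_union_of_lens` — **trichotomy in a lens**: `V ⊆ S ∪ I⁺(S) ∪ I⁻(S)` (an endless timelike
  curve of `V` through a point of `V` meets `S ∩ V`);
* `exists_mem_of_curve_in_lens` — **the tail argument**: a future timelike curve of `V` with a
  least parameter, without future endpoint in `V`, starting in `I⁻(S)`, meets `S` (extended to the
  past inside `V` it is an endless timelike curve of `V`; a crossing before the start would put the
  starting point in `I⁺(S)`, against achronality);
* `IsAchronal.not_mem_of_mem_chronologicalPast`, `mem_chronologicalFuture_of_mem_causalFuture_of_mem`
  (push-up in the form `x ≪ y ≤ z ⇒ x ≪ z`).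

The consequences for the causality of `S` (no future timelike curve from `V ∩ I⁻(S)` avoids `S`;
`I⁺(x) ∩ I⁻(S) ⊆ V` for `x ∈ V ∩ I⁻(S)`; `J⁺(S) ⊆ S ∪ I⁺(S)`) are drawn in
`PhotonSphereChannelsTameCensorshipLensDomain.lean`. Tools: `exists_first_exit` (first parameter at which a path leaves an open set),
`isFutureTimelikeCurveOn_congr_iff` and the lifting of curves into an open sub-spacetime
(`exists_lift_opens`); the past extension of future-endless timelike curves is
`SubdataDevelopmentsEmbed.exists_isEndlessTimelikeCurve_extends_past` (route `SwallowTheDatum`).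

Everything is proved; no definitions, no named facts.

## References

* B. O'Neill, *Semi-Riemannian geometry with applications to relativity*, Academic Press 1983,
  Ch. 14, Lemma 14.29, Def. 14.35, Thm. 14.38, Lemmas 14.42–14.43, Thm. 14.55A (pp. 415–432).
  [ONeillSemiRiemannian1983]
* S. W. Hawking, G. F. R. Ellis, *The large scale structure of space-time*, CUP 1973, §6.5–6.6,
  Prop. 6.6.3. [HawkingEllis1973CUP]
-/

noncomputable section

-- The tree namespace `Summit.FinalStateConjecture.FinalStateConjecture.…` (summit = sub-problem)
-- repeats a component by design (D-0022), which the `dupNamespace` linter would flag on every decl.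
set_option linter.dupNamespace false

open Bundle Set Filter Function Topology TopologicalSpace
open scoped Manifold ContDiff Topology

open Literature.Geometry.Lorentzian
open Summit.FinalStateConjecture.FinalStateConjecture.Theorems.SubdataDevelopmentsEmbed
  (exists_isEndlessTimelikeCurve_extends_past)

namespace Summit.FinalStateConjecture.FinalStateConjecture.Theorems.PhotonSphereChannels.TameCensorshipCrush

/-! ### Topological preliminaries -/

section Topology

variable {M : Type*} [TopologicalSpace M]

/-- The final segment `D ∩ [b, ∞)`, `b ∈ D`, of a future-endless curve is future endless (a future
endpoint only depends on the future end of the parameter set). [folklore] -/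
theorem isFutureEndless_inter_Ici {Δ : ℝ → M} {D : Set ℝ} (h : IsFutureEndless Δ D) {b : ℝ}
    (hb : b ∈ D) : IsFutureEndless Δ (D ∩ Ici b) := by
  refine ⟨⟨b, hb, self_mem_Ici⟩, fun e he ↦ h.2 e ?_⟩
  rw [hasFutureEndpoint_iff (⟨b, hb, self_mem_Ici⟩ : (D ∩ Ici b).Nonempty)] at he
  rw [hasFutureEndpoint_iff ⟨b, hb⟩]
  intro V hV
  obtain ⟨t, ht, htV⟩ := he V hV
  exact ⟨t, ht.1, fun t₁ ht₁ htt₁ ↦ htV t₁ ⟨ht₁, le_trans ht.2 htt₁⟩ htt₁⟩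

/-- A future endpoint only depends on the values of the curve on the parameter set. [folklore] -/
theorem hasFutureEndpoint_congr_eqOn {γ γ' : ℝ → M} {s : Set ℝ} (h : EqOn γ γ' s) (p : M) :
    HasFutureEndpoint γ s p ↔ HasFutureEndpoint γ' s p := by
  have hfun : (fun t : s ↦ γ t) = fun t : s ↦ γ' t := funext fun t ↦ h t.2
  unfold HasFutureEndpoint
  rw [hfun]

/-- A past endpoint only depends on the values of the curve on the parameter set. [folklore] -/
theorem hasPastEndpoint_congr_eqOn {γ γ' : ℝ → M} {s : Set ℝ} (h : EqOn γ γ' s) (p : M) :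
    HasPastEndpoint γ s p ↔ HasPastEndpoint γ' s p := by
  have hfun : (fun t : s ↦ γ t) = fun t : s ↦ γ' t := funext fun t ↦ h t.2
  unfold HasPastEndpoint
  rw [hfun]

/-- **First exit.** If `β` is continuous on `[a, b]`, `β a ∈ O`, `β b ∉ O` and `O` is open, there
is a first parameter `t ∈ (a, b]` with `β t ∉ O`; before it the path stays in `O`. [folklore] -/
theorem exists_first_exit {O : Set M} (hO : IsOpen O) {β : ℝ → M} {a b : ℝ} (hab : a ≤ b)
    (hβ : ContinuousOn β (Icc a b)) (ha : β a ∈ O) (hb : β b ∉ O) :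
    ∃ t ∈ Ioc a b, β t ∉ O ∧ ∀ s ∈ Ico a t, β s ∈ O := by
  set T : Set ℝ := Icc a b ∩ β ⁻¹' Oᶜ with hT
  have hTc : IsClosed T := hβ.preimage_isClosed_of_isClosed isClosed_Icc hO.isClosed_compl
  have hbT : b ∈ T := ⟨right_mem_Icc.mpr hab, hb⟩
  have hTne : T.Nonempty := ⟨b, hbT⟩
  have hTbdd : BddBelow T := ⟨a, fun t ht ↦ ht.1.1⟩
  set t₀ := sInf T with ht₀
  have ht₀T : t₀ ∈ T := hTc.csInf_mem hTne hTbdd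
  have ht₀a : a < t₀ := by
    rcases eq_or_lt_of_le ht₀T.1.1 with h | h
    · exact absurd ha (by rw [h]; exact ht₀T.2)
    · exact h
  refine ⟨t₀, ⟨ht₀a, ht₀T.1.2⟩, ht₀T.2, fun s hs ↦ ?_⟩
  by_contra hsO
  have hsT : s ∈ T := ⟨⟨hs.1, le_trans hs.2.le ht₀T.1.2⟩, hsO⟩
  exact absurd (csInf_le hTbdd hsT) (not_le.mpr hs.2)

omit [TopologicalSpace M] in
/-- **Lifting a map into a subset**: for `O ⊆ M` containing a point `z₀` there is a map
`δ' : ℝ → O` agreeing with `δ : ℝ → M` wherever `δ` takes values in `O`. [folklore] -/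
theorem exists_lift_opens {O : Set M} {z₀ : M} (hz₀ : z₀ ∈ O) (δ : ℝ → M) :
    ∃ δ' : ℝ → O, ∀ t, δ t ∈ O → (δ' t : M) = δ t := by
  classical
  exact ⟨fun t ↦ if h : δ t ∈ O then ⟨δ t, h⟩ else ⟨z₀, hz₀⟩, fun t ht ↦ by simp [dif_pos ht]⟩

/-- A lift into an open set agrees with the curve near every parameter at which the curve is
continuous with value in the set. [folklore] -/
theorem eventuallyEq_of_lift {O : Set M} (hO : IsOpen O) {δ : ℝ → M} {δ' : ℝ → O}
    (hδ' : ∀ t, δ t ∈ O → (δ' t : M) = δ t) {t : ℝ} (hc : ContinuousAt δ t) (ht : δ t ∈ O) :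
    (Subtype.val ∘ δ') =ᶠ[𝓝 t] δ := by
  filter_upwards [hc.preimage_mem_nhds (hO.mem_nhds ht)] with u hu using hδ' u hu

end Topology

/-! ### Timelike curves: locality and past extension -/

section Curves

variable {E : Type*} [NormedAddCommGroup E] [NormedSpace ℝ E] {H : Type*} [TopologicalSpace H]
  {I : ModelWithCorners ℝ E H} {n : ℕ∞ω} {M : Type*} [TopologicalSpace M] [ChartedSpace H M]
  [IsManifold I ∞ M]

variable {g : LorentzianMetric I n M} {τ : TimeOrientation g}

/-- Being a future timelike curve on `s` is a local property of the germs of the curve at the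
points of `s`: two curves with the same germs at all points of `s` are future timelike on `s`
simultaneously (same points, same velocities; the one-directional form is
`isFutureTimelikeCurveOn_congr_of_eventuallyEq` of the `ZeroEnergyRigidity` files). O'Neill 1983,
Ch. 14, p. 402. [folklore] -/
theorem isFutureTimelikeCurveOn_congr_iff {γ γ' : ℝ → M} {s : Set ℝ}
    (h : ∀ t ∈ s, γ' =ᶠ[𝓝 t] γ) :
    g.IsFutureTimelikeCurveOn τ γ' s ↔ g.IsFutureTimelikeCurveOn τ γ s := by
  have key : ∀ {γ₁ γ₂ : ℝ → M}, (∀ t ∈ s, γ₂ =ᶠ[𝓝 t] γ₁) →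
      g.IsFutureTimelikeCurveOn τ γ₁ s → g.IsFutureTimelikeCurveOn τ γ₂ s := by
    intro γ₁ γ₂ h12 hγ t ht
    obtain ⟨hd, htl, hfd⟩ := hγ t ht
    have heq : γ₂ t = γ₁ t := (h12 t ht).eq_of_nhds
    have hd' : MDifferentiableAt 𝓘(ℝ, ℝ) I γ₂ t := (h12 t ht).mdifferentiableAt_iff.mpr hd
    have hv : HEq (velocity I γ₂ t) (velocity I γ₁ t) := by
      unfold velocity
      have hm := (h12 t ht).mfderiv_eq (I := 𝓘(ℝ, ℝ)) (I' := I)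
      congr 1
    refine ⟨hd', ?_, ?_⟩
    · have aux : ∀ (x y : M) (hxy : x = y) (v : TangentSpace I x) (w : TangentSpace I y),
          HEq v w → g.IsTimelike w → g.IsTimelike v := by
        rintro x y rfl v w hvw hw
        rw [heq_iff_eq] at hvw
        rw [hvw]; exact hw
      exact aux _ _ heq _ _ hv htl
    · have aux : ∀ (x y : M) (hxy : x = y) (v : TangentSpace I x) (w : TangentSpace I y),
          HEq v w → τ.IsFutureDirected w → τ.IsFutureDirected v := by
        rintro x y rfl v w hvw hw
        rw [heq_iff_eq] at hvw
        rw [hvw]; exact hw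
      exact aux _ _ heq _ _ hv hfd
  exact ⟨key fun t ht ↦ (h t ht).symm, key h⟩

end Curves

/-! ### Causality in a lens -/

section Lens

variable {E : Type*} [NormedAddCommGroup E] [NormedSpace ℝ E] {H : Type*} [TopologicalSpace H]
  {I : ModelWithCorners ℝ E H} {n : ℕ∞ω} {M : Type*} [TopologicalSpace M] [ChartedSpace H M]
  [IsManifold I ∞ M] [T2Space M] [SecondCountableTopology M] [I.Boundaryless]
  [FiniteDimensional ℝ E]

variable {g : LorentzianMetric I n M} {τ : TimeOrientation g}
  (hres : PseudoRiemannianMetric.contMDiff_restrict (I := I) (n := n) (M := M))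
  (hτ : τ.contMDiff_restrict)

/-- **Trichotomy in a lens.** If `S ∩ V` is a Cauchy hypersurface of the open sub-spacetime `V`,
then every point of `V` lies on `S`, in `I⁺(S)` or in `I⁻(S)`: the endless timelike curve of `V`
through the point (`exists_isEndlessTimelikeCurve_through`) meets `S ∩ V`, after, at or before
it. O'Neill 1983, Ch. 14, proof of Lemma 29 (p. 415). [cite: ONeillSemiRiemannian1983, Ch. 14, Lemma 29 (p. 415)] -/
theorem mem_union_of_lens (hn : 2 ≤ n) {S : Set M} {V : Opens M}
    (hV : (g.restrict hres V).IsCauchyHypersurface (τ.restrict hres hτ V) (Subtype.val ⁻¹' S))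
    {w : M} (hw : w ∈ V) :
    w ∈ S ∨ w ∈ g.chronologicalFuture τ S ∨ w ∈ g.chronologicalPast τ S := by
  obtain ⟨Δ, D, hΔ, h0D, hΔ0⟩ :=
    LorentzianMetric.exists_isEndlessTimelikeCurve_through (g := g.restrict hres V) (τ := τ.restrict hres hτ V)
      hn (⟨w, hw⟩ : V)
  obtain ⟨t₁, ⟨ht₁D, ht₁S⟩, -⟩ := hV Δ D hΔ
  have hc : g.IsFutureTimelikeCurveOn τ (Subtype.val ∘ Δ) D :=
    (LorentzianMetric.isFutureTimelikeCurveOn_restrict_iff g τ hres hτ V).1 hΔ.2.1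
  have hw0 : (Subtype.val ∘ Δ) 0 = w := by
    show (Δ 0 : M) = w
    rw [hΔ0]
  rcases lt_trichotomy t₁ 0 with h | h | h
  · refine Or.inr (Or.inl ⟨(Δ t₁ : M), ht₁S, Subtype.val ∘ Δ, t₁, 0, h,
      hc.mono (hΔ.1.out ht₁D h0D), rfl, hw0⟩)
  · left
    rw [← hw0, ← h]
    exact ht₁S
  · refine Or.inr (Or.inr ?_)
    have h1 : (Δ t₁ : M) ∈ g.chronologicalFuture τ {w} :=
      ⟨w, rfl, Subtype.val ∘ Δ, 0, t₁, h, hc.mono (hΔ.1.out h0D ht₁D), hw0, rfl⟩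
    have h2 : w ∈ g.chronologicalPast τ {(Δ t₁ : M)} :=
      LorentzianMetric.mem_chronologicalPast_of_mem_chronologicalFuture h1
    have ht₁S' : (Δ t₁ : M) ∈ S := ht₁S
    exact LorentzianMetric.chronologicalPast_mono (singleton_subset_iff.mpr ht₁S') h2

/-- **The tail argument.** Let `S` be achronal and `S ∩ V` a Cauchy hypersurface of the open
sub-spacetime `V`. A future timelike curve `δ'` of `V` on an interval `J` with least element `t₀`,
without future endpoint in `V`, starting at a point of `I⁻(S)`, meets `S`: extended to the past
inside `V` (`exists_isEndlessTimelikeCurve_extends_past`) it becomes an endless timelike curve of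
`V`, which meets `S ∩ V`; a crossing before `t₀` would put the starting point in `I⁺(S)`, against
achronality. O'Neill 1983, Ch. 14, Lemma 14.29 and Thm. 14.38.
[cite: ONeillSemiRiemannian1983, Ch. 14, Thm. 14.38 (pp. 421–423)] -/
theorem exists_mem_of_curve_in_lens (hn : 2 ≤ n) {S : Set M} (hA : g.IsAchronal τ S)
    {V : Opens M}
    (hV : (g.restrict hres V).IsCauchyHypersurface (τ.restrict hres hτ V) (Subtype.val ⁻¹' S))
    {δ' : ℝ → V} {J : Set ℝ} (hJ : J.OrdConnected) {t₀ : ℝ} (ht₀ : t₀ ∈ J) (hJt₀ : J ⊆ Ici t₀)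
    (hδ' : (g.restrict hres V).IsFutureTimelikeCurveOn (τ.restrict hres hτ V) δ' J)
    (hend : IsFutureEndless δ' J) (hz : (δ' t₀ : M) ∈ g.chronologicalPast τ S) :
    ∃ t ∈ J, (δ' t : M) ∈ S := by
  have hdisj : Disjoint (g.chronologicalFuture τ S) (g.chronologicalPast τ S) :=
    hA.disjoint_chronologicalFuture_chronologicalPast
  obtain ⟨Δ, D', hΔ, hJD', hΔJ, hnew⟩ :=
    exists_isEndlessTimelikeCurve_extends_past (g := g.restrict hres V)
      (τ := τ.restrict hres hτ V) hn hJ ht₀ hJt₀ hδ' hend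
  obtain ⟨t₁, ⟨ht₁D', ht₁S⟩, -⟩ := hV Δ D' hΔ
  by_cases ht₁J : t₁ ∈ J
  · refine ⟨t₁, ht₁J, ?_⟩
    rw [← hΔJ t₁ ht₁J]
    exact ht₁S
  · exfalso
    -- the crossing is a new point, in `I⁻_V(δ' t₀)`; hence `δ' t₀ ∈ I⁺(S)`
    have hlow : Δ t₁ ∈ (g.restrict hres V).chronologicalPast (τ.restrict hres hτ V) {δ' t₀} :=
      hnew t₁ ht₁D' ht₁J
    have hup : δ' t₀ ∈ (g.restrict hres V).chronologicalFuture (τ.restrict hres hτ V) {Δ t₁} :=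
      LorentzianMetric.mem_chronologicalFuture_of_mem_chronologicalPast hlow
    obtain ⟨p, hp, γ, a, b, hab, hγ, hγa, hγb⟩ := hup
    rw [mem_singleton_iff] at hp
    subst hp
    -- read the timelike curve `γ` of `V` from `Δ t₁` to `δ' t₀` in `M`
    have hγM : g.IsFutureTimelikeCurveOn τ (Subtype.val ∘ γ) (Icc a b) :=
      (LorentzianMetric.isFutureTimelikeCurveOn_restrict_iff g τ hres hτ V).1 hγ
    have hzfut : (δ' t₀ : M) ∈ g.chronologicalFuture τ S :=
      ⟨(Δ t₁ : M), ht₁S, Subtype.val ∘ γ, a, b, hab, hγM, by show (γ a : M) = _; rw [hγa],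
        by show (γ b : M) = _; rw [hγb]⟩
    exact Set.disjoint_left.mp hdisj hzfut hz


omit [T2Space M] [SecondCountableTopology M] [I.Boundaryless] [FiniteDimensional ℝ E] in
/-- A point of `I⁻(S)` is not on the achronal set `S`. O'Neill 1983, Ch. 14, p. 413. [folklore] -/
theorem not_mem_of_isAchronal_of_mem_chronologicalPast {S : Set M} (hA : g.IsAchronal τ S) {x : M}
    (hx : x ∈ g.chronologicalPast τ S) : x ∉ S := by
  intro hxS
  obtain ⟨s₀, hs₀, γ, a, b, hab, hγ, hγa, hγb⟩ := hx
  have h1 : x ∈ g.chronologicalPast τ {s₀} := ⟨s₀, rfl, γ, a, b, hab, hγ, hγa, hγb⟩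
  exact hA x hxS s₀ hs₀ (LorentzianMetric.mem_chronologicalFuture_of_mem_chronologicalPast h1)

end Lens

end Summit.FinalStateConjecture.FinalStateConjecture.Theorems.PhotonSphereChannels.TameCensorshipCrush

end
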